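import Literature.Barriers.QuantumAdvantage.AaronsonChenAdvice
import Literature.Computability.QuantumComplexity.OraclePathSums
import HarnessLib

/-!
# Aaronson–Chen 2017, Lemma 5.3: the two physical predicates of the advice language as exact `√2`-threshold tests on path-pair counts

Support file for `aaronsonChen2017_lem53` (`AaronsonChenOracle.lean`). The machine half of
Aaronson–Chen 2017, Lemma 5.3 [AaronsonChen2017, §5.3 pp. 22–23] is reduced
(`AaronsonChenMachine.lean`: `aaronsonChen2017_lem53_of_advice`) to "`TQBF` is `PSPACE`-hard" and
"`AcProto.advLang ∈ PSPACE`", and the latter (`AaronsonChenAdvice.lean`: `advBit_eq_true_iff`) to the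
two PHYSICAL predicates of the simulator's own replaced run — `HeavyLang` ("we query all `x` with
`Q(x) ≥ τ`", p. 22: a query magnitude of the state before a gate is at least `1/a`) and `CdfLang`
("it first takes a sample `z` by measuring `|v_{T+1}⟩`", p. 23: the cumulative Born weight of the
final state exceeds the coin numeral `r/2^{|r|}`). "All the computations can be done in `PSPACE`"
(p. 23) because both are SIGN CONDITIONS on integer counts of pairs of Feynman paths through the
replaced circuit (Adleman–DeMarrais–Huang 1997, Lemma 6.10; Bernstein–Vazirani 1997, §8.4), which is
the form the tree's path-sum library for Clifford+`T` circuits with annotated oracle gates decides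
exactly (`QuantumComplexity/OraclePathSums.lean`: `annProd`, `annWeight`, the pair counts
`annSetA`/`annSetB`, `2^h W(S) = A_S + (√2/2) B_S`, and the integer test `linFormTest`).

This file is the bridge between the two vocabularies (library-first: no new analysis, only the
identification), so that the `PSPACE` membership of `HeavyLang`/`CdfLang` becomes an instance of the
polynomial-space evaluation of `linFormTest` on pair counts of CODED annotated gate lists:

* `AcSim.annTab tabs gs` — the gate list annotated with its answer languages `TQBF ⊕ tabs u`
  (`u` = position), and **`AcSim.tabRun_eq_annProd_mulVec`**: the tabled run (`AaronsonChenTables.lean`)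
  IS the annotated product, `tabRun tabs gs v = annProd (annTab tabs gs) *ᵥ v`; `annTab_take`,
  `annHCount_annTab`, `getElem?_annTab`;
* **`AcSim.mem_heavyList_annProd_iff`**, `AcSim.mem_stageListOf_annProd_iff` — on the output of an
  annotated list on a basis state, the heavy tails / the strings queried at a gate are decided by
  `linFormTest (2^h) (−a) 0 A_S B_S 0 0 = false` on the query cylinder `S = {x | q_e(x) = 1u}`
  (`le_annWeight_iff`, `queryWeight_eq_annWeight`);
* `AcProto.w0` (the basis label of `|x₀, 0^m⟩`, `v0 = basisState w0`) and
  **`AcProto.mem_stageList_iff_linFormTest`** — `u ∈ stageList x₀ tabs n` iff gate `n` is a query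
  gate with `k + 1` query wires, `|u| = k`, and either the table is small (`2^k ≤ a`) or the heavy test
  on the pair counts of `annTab tabs (gates.take n)` from `w0` fails to refute `1/a ≤ Q(1u)`; hence
  **`AcProto.mem_HeavyLang_iff_linFormTest`**;
* `cdfR_map_qregEquiv_eq_annWeight` — the cumulative distribution, in numeral order, of the Born law
  of `annProd gas |w⟩` at `i` is the set weight of `{y | ⟦y⟧ ≤ i}`; `lt_mul_annWeight_iff` — the
  dyadic comparison `j < M · W(S)` is `linFormTest (−j·2^h) M 0 A_S B_S 0 0 = true`; hence
  **`AcProto.sel_iff_linFormTest`** and **`AcProto.mem_CdfLang_iff_linFormTest`**.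

## References

* [AaronsonChen2017] S. Aaronson, L. Chen, *Complexity-theoretic foundations of quantum supremacy
  experiments*, CCC 2017 (doi:10.4230/LIPIcs.CCC.2017.22; arXiv:1612.05903), Lemma 5.3, §5.3
  (pp. 22–23), read via `lit read arxiv:1612.05903 --pages 21-23`.
* [AdlemanDeMarraisHuang1997] L. M. Adleman, J. DeMarrais, M.-D. A. Huang, *Quantum computability*,
  SIAM J. Comput. 26 (1997), §6, Lemma 6.10 (pairs of paths), as formalized in
  `CliffordTPathSums.lean` / `OraclePathSums.lean`.
* [BennettBernsteinBrassardVazirani1997] Def. 3.2 (query magnitude), as `queryWeight`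
  (`HybridArgument.lean`).
* [KnuthTAOCP2] §3.4.1 A (inversion method), as `cdfR`/`invCdfVia` (`InverseCdfSampling.lean`).
-/

noncomputable section

namespace Literature.Barriers.QuantumAdvantage

open MeasureTheory _root_.Computability Matrix Polynomial Literature.Computability.Complexity
  Literature.Computability.Cryptography Literature.Computability.QuantumComplexity

/-! ### The tabled run as an annotated gate list -/

namespace AcSim

variable {N : ℕ}

/-- **The annotated form of a tabled gate list**: the gate at position `u` carries the answer
language `TQBF ⊕ tabs u` of the tabled run (ignored by gate symbols).
[cite: AaronsonChen2017, §5.3 (p. 22, "we replaced the f_{n_i} gate with a g_i gate"; p. 23, "C_final")] -/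
def annTab (tabs : ℕ → Set (List Bool)) : List (QGate cliffordT N) → List (AnnGate N)
  | [] => []
  | g :: gs => (g, oracleJoin TQBF (tabs 0)) :: annTab (fun u => tabs (u + 1)) gs

/-- `annTab` of the empty list (definitional). [folklore] -/
@[simp] theorem annTab_nil (tabs : ℕ → Set (List Bool)) : annTab tabs ([] : List (QGate cliffordT N)) = [] := rfl

/-- `annTab` of a cons (definitional). [folklore] -/
@[simp] theorem annTab_cons (tabs : ℕ → Set (List Bool)) (g : QGate cliffordT N) (gs : List (QGate cliffordT N)) :
    annTab tabs (g :: gs) = (g, oracleJoin TQBF (tabs 0)) :: annTab (fun u => tabs (u + 1)) gs := rfl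

/-- `annTab` preserves the length. [folklore] -/
@[simp] theorem length_annTab (tabs : ℕ → Set (List Bool)) :
    ∀ gs : List (QGate cliffordT N), (annTab tabs gs).length = gs.length
  | [] => rfl
  | g :: gs => by rw [annTab_cons, List.length_cons, List.length_cons, length_annTab]

/-- Forgetting the annotations gives back the gate list. [folklore] -/
@[simp] theorem map_fst_annTab :
    ∀ (tabs : ℕ → Set (List Bool)) (gs : List (QGate cliffordT N)), (annTab tabs gs).map Prod.fst = gs
  | _, [] => rfl
  | tabs, g :: gs => by rw [annTab_cons, List.map_cons, map_fst_annTab]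

/-- The Hadamard count of the annotated list is that of the gate list. [folklore] -/
@[simp] theorem annHCount_annTab (tabs : ℕ → Set (List Bool)) (gs : List (QGate cliffordT N)) :
    annHCount (annTab tabs gs) = hCount gs := by
  rw [annHCount, map_fst_annTab]

/-- The entries of the annotated list: gate `u` with the language `TQBF ⊕ tabs u`. [folklore] -/
theorem getElem?_annTab :
    ∀ (tabs : ℕ → Set (List Bool)) (gs : List (QGate cliffordT N)) (u : ℕ),
      (annTab tabs gs)[u]? = gs[u]?.map fun g => (g, oracleJoin TQBF (tabs u))
  | _, [], u => by simp
  | tabs, g :: gs, 0 => by simp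
  | tabs, g :: gs, u + 1 => by
    rw [annTab_cons, List.getElem?_cons_succ, List.getElem?_cons_succ, getElem?_annTab]

/-- `annTab` only consults the tables of the gates present. [folklore] -/
theorem annTab_congr {tabs tabs' : ℕ → Set (List Bool)} :
    ∀ (gs : List (QGate cliffordT N)), (∀ u < gs.length, tabs u = tabs' u) → annTab tabs gs = annTab tabs' gs
  | [], _ => rfl
  | g :: gs, h => by
    rw [annTab_cons, annTab_cons, h 0 (by simp)]
    congr 1
    exact annTab_congr gs fun u hu => h (u + 1) (by simpa using hu)

/-- `annTab` of a prefix is the prefix of `annTab`. [folklore] -/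
theorem annTab_take :
    ∀ (tabs : ℕ → Set (List Bool)) (gs : List (QGate cliffordT N)) (n : ℕ),
      annTab tabs (gs.take n) = (annTab tabs gs).take n
  | _, [], n => by simp
  | tabs, g :: gs, 0 => by simp
  | tabs, g :: gs, n + 1 => by
    rw [List.take_succ_cons, annTab_cons, annTab_cons, List.take_succ_cons, annTab_take]

/-- The matrix of an annotated gate `(g, A)` is `g` relative to `A` (definitional). [folklore] -/
theorem annSem_mk (g : QGate cliffordT N) (A : Language Bool) : annSem (g, A) = g.toMatrix A := rfl

/-- **The tabled run is the annotated product**: running `gs` with the gate at position `u`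
answered by `TQBF ⊕ tabs u` from the vector `v` gives `annProd (annTab tabs gs) v`.
[cite: AaronsonChen2017, §5.3 (p. 23, "C_final")] [cite: AdlemanDeMarraisHuang1997, §6 (circuits as products of local unitaries)] -/
theorem tabRun_eq_annProd_mulVec :
    ∀ (tabs : ℕ → Set (List Bool)) (gs : List (QGate cliffordT N)) (v : QReg N → ℂ),
      tabRun tabs gs v = annProd (annTab tabs gs) *ᵥ v
  | _, [], v => by simp
  | tabs, g :: gs, v => by
    rw [tabRun_cons, tabRun_eq_annProd_mulVec, annTab_cons, annProd_cons, ← Matrix.mulVec_mulVec]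
    rfl

/-! ### Heavy tails and queried strings of the output of an annotated list, as threshold tests -/

/-- The query cylinder of the tail `u` at the wires `e`: the basis labels whose query register
spells `1u`. [cite: BennettBernsteinBrassardVazirani1997, Def. 3.2] -/
theorem setOf_queryOf_mem_singleton {k : ℕ} (e : Fin (k + 1) ↪ Fin N) (u : List Bool) :
    {x : QReg N | queryOf e x ∈ ({true :: u} : Set (List Bool))} = {x | queryOf e x = true :: u} := by
  ext x; simp

/-- **The heavy tails of the output of an annotated list, by the integer test**: `u` (of the right
length) is heavy, `1/a ≤ Q(1u)`, iff the linear-form test `0 < 2^h − a·2^h·W(S_u)` FAILS, `S_u` the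
query cylinder of `1u`, `h` the Hadamard count. [cite: AaronsonChen2017, §5.3 (p. 22, "we query all x with Q(x) ≥ τ"; p. 23, "all the computations can be done in PSPACE")] -/
theorem mem_heavyList_annProd_iff {a k : ℕ} (ha : 0 < a) (e : Fin (k + 1) ↪ Fin N) (gas : List (AnnGate N))
    (w : QReg N) (u : List Bool) :
    u ∈ heavyList a e (annProd gas *ᵥ basisState w) ↔ u.length = k - 1 ∧
      linFormTest (2 ^ annHCount gas) (-(a : ℤ)) 0 (annSetA gas w {x | queryOf e x = true :: u})
        (annSetB gas w {x | queryOf e x = true :: u}) 0 0 = false := by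
  rw [mem_heavyList_iff, queryWeight_eq_annWeight, setOf_queryOf_mem_singleton, le_annWeight_iff ha]

/-- **The strings queried at a gate of the output of an annotated list, by the integer test**: none
unless the gate is a query gate with `k + 1` query wires; then the tails `u` of length `k`, all of
them if the table is small (`2^k ≤ b`), else the heavy ones. [cite: AaronsonChen2017, §5.3 (p. 22, "Construction and Analysis of g")] -/
theorem mem_stageListOf_annProd_iff {a : ℕ} (ha : 0 < a) (b : ℕ) (g : QGate cliffordT N) (gas : List (AnnGate N))
    (w : QReg N) (u : List Bool) :
    u ∈ stageListOf a b g (annProd gas *ᵥ basisState w) ↔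
      ∃ (k : ℕ) (e : Fin (k + 1 + 1) ↪ Fin N), g = .oracle (k + 1) e ∧ u.length = k ∧
        (2 ^ k ≤ b ∨ (¬ 2 ^ k ≤ b ∧
          linFormTest (2 ^ annHCount gas) (-(a : ℤ)) 0 (annSetA gas w {x | queryOf e x = true :: u})
            (annSetB gas w {x | queryOf e x = true :: u}) 0 0 = false)) := by
  cases g with
  | gate g e =>
    simp only [stageListOf, List.not_mem_nil, false_iff, not_exists, not_and]
    intro k e' h
    cases h
  | oracle k e =>
    cases k with
    | zero =>
      simp only [stageListOf, List.not_mem_nil, false_iff, not_exists, not_and]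
      intro k e' h
      cases h
    | succ k =>
      simp only [stageListOf]
      constructor
      · intro h
        refine ⟨k, e, rfl, ?_⟩
        split_ifs at h with hb
        · exact ⟨mem_allStr_iff.1 h, Or.inl hb⟩
        · rw [mem_heavyList_annProd_iff ha] at h
          exact ⟨by simpa using h.1, Or.inr ⟨hb, h.2⟩⟩
      · rintro ⟨k', e', hge, hlen, hcase⟩
        simp only [QGate.oracle.injEq, Nat.add_right_cancel_iff] at hge
        obtain ⟨rfl, he⟩ := hge
        subst he
        split_ifs with hb
        · exact mem_allStr_iff.2 hlen
        · rcases hcase with hb' | ⟨-, ht⟩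
          · exact absurd hb' hb
          · rw [mem_heavyList_annProd_iff ha]
            exact ⟨by simpa using hlen, ht⟩

end AcSim

/-! ### Cumulative Born weights in numeral order as set weights, and dyadic comparisons -/

section Cdf

variable {N : ℕ}

/-- A push-forward along an equivalence evaluates at the image point. [folklore] -/
theorem pmf_map_equiv_apply {α β : Type*} (e : α ≃ β) (p : PMF α) (a : α) : (p.map e) (e a) = p a := by
  rw [PMF.map_apply, tsum_eq_single a]
  · simp
  · intro a' ha'
    rw [if_neg]
    exact fun h => ha' (e.injective h).symm

/-- **The cumulative distribution of the Born law in numeral order is a set weight**: for the output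
`annProd gas |w⟩` of an annotated list, `F(i) = Σ_{⟦y⟧ ≤ i} |⟨y|U|w⟩|² = W({y | ⟦y⟧ ≤ i})`.
[cite: AaronsonChen2017, §5.3 (p. 23, "measuring |v_{T+1}⟩ in the computational basis")] [cite: KnuthTAOCP2, §3.4.1 A] -/
theorem cdfR_map_qregEquiv_eq_annWeight (gas : List (AnnGate N)) (w : QReg N) (i : Fin (2 ^ N)) :
    cdfR ((bornPMF (annProd gas *ᵥ basisState w)).map (qregEquiv N)) i =
      annWeight gas w {y | bitsToNat (List.ofFn y) ≤ i} := by
  classical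
  have hv : ∑ y, ‖(annProd gas *ᵥ basisState w) y‖ ^ 2 = 1 := normSq_annProd_mulVec_basisState gas w
  unfold cdfR annWeight
  rw [Finset.sum_filter, ← (qregEquiv N).sum_comp]
  refine Finset.sum_congr rfl fun y _ => ?_
  have hy : ((qregEquiv N) y ≤ i) ↔ bitsToNat (List.ofFn y) ≤ i := by
    rw [Fin.le_def, qregEquiv_apply, qregFin_val]
  by_cases h : bitsToNat (List.ofFn y) ≤ i
  · rw [if_pos (hy.2 h), if_pos (show y ∈ {y : QReg N | bitsToNat (List.ofFn y) ≤ i} from h),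
      pmf_map_equiv_apply, bornPMF_apply_of_sum_eq_one hv, ENNReal.toReal_ofReal (sq_nonneg _)]
  · rw [if_neg (fun h' => h (hy.1 h')), if_neg (show y ∉ {y : QReg N | bitsToNat (List.ofFn y) ≤ i} from h)]

/-- **The dyadic comparison** `j < M · W(S)` (the coin numeral against a scaled cumulative weight) is
the linear-form test with `c₁ = M`, `c₂ = 0`, `c₀ = −j·2^h`. [cite: AaronsonChen2017, §5.3 (p. 23)] -/
theorem lt_mul_annWeight_iff (j M : ℤ) (gas : List (AnnGate N)) (w : QReg N) (S : Set (QReg N)) :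
    (j : ℝ) < M * annWeight gas w S ↔
      linFormTest (-(j * 2 ^ annHCount gas)) M 0 (annSetA gas w S) (annSetB gas w S) 0 0 = true := by
  have key := linFormTest_iff (-(j * 2 ^ annHCount gas)) M 0 (annSetA gas w S) (annSetB gas w S) 0 0
  rw [← two_pow_mul_annWeight] at key
  have hp : (0 : ℝ) < (2 : ℝ) ^ annHCount gas := by positivity
  rw [key]
  push_cast
  constructor
  · intro h
    have h2 : 0 < (2 : ℝ) ^ annHCount gas * ((M : ℝ) * annWeight gas w S - j) := mul_pos hp (sub_pos.2 h)
    nlinarith [h2]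
  · intro h
    by_contra h'
    have h2 : 0 ≤ (2 : ℝ) ^ annHCount gas * ((j : ℝ) - M * annWeight gas w S) :=
      mul_nonneg hp.le (sub_nonneg.2 (not_lt.1 h'))
    nlinarith [h2]

end Cdf

/-! ### The predicates of the advice language -/

namespace AcProto

variable (P : AcProto)

/-- The basis label `x₀ 0^m` of the initial state (`v0 = basisState w0`). [cite: AaronsonChen2017, §2.2 (p. 12)] -/
def w0 (x₀ : List Bool) : QReg (P.nq x₀) := padInput x₀.get (P.F.ancillas x₀.length)

/-- The initial state is the basis state of `w0` (definitional). [folklore] -/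
theorem v0_eq_basisState (x₀ : List Bool) : P.v0 x₀ = basisState (P.w0 x₀) := rfl

/-- **The state before gate `n` of the tabled run is the output of the annotated prefix** on the
basis label `w0`. [cite: AaronsonChen2017, §5.3 (p. 23, "C_final")] -/
theorem tabRun_take_eq_annProd (x₀ : List Bool) (tabs : ℕ → Set (List Bool)) (n : ℕ) :
    AcSim.tabRun tabs ((P.gates x₀).take n) (P.v0 x₀) =
      annProd (AcSim.annTab tabs ((P.gates x₀).take n)) *ᵥ basisState (P.w0 x₀) :=
  AcSim.tabRun_eq_annProd_mulVec _ _ _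

/-- The final state of the tabled run is the output of the annotated gate list on `w0`. [folklore] -/
theorem tabRun_eq_annProd (x₀ : List Bool) (tabs : ℕ → Set (List Bool)) :
    AcSim.tabRun tabs (P.gates x₀) (P.v0 x₀) = annProd (AcSim.annTab tabs (P.gates x₀)) *ᵥ basisState (P.w0 x₀) :=
  AcSim.tabRun_eq_annProd_mulVec _ _ _

/-- The budget is positive. [folklore] -/
theorem bud_pos (x₀ : List Bool) : 0 < P.bud x₀ := P.one_le_bud x₀

/-- **The strings queried at stage `n`, by the integer test on path-pair counts**: `u ∈ stageList x₀ tabs n`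
iff gate `n` is a query gate `oracle (k+1) e`, `|u| = k`, and either the table is small
(`2^k ≤ a`, `a = bud x₀`) or the heavy test on the pair counts of the annotated prefix
`annTab tabs (gates.take n)` from `w0` does not refute `1/a ≤ Q(1u)`.
[cite: AaronsonChen2017, §5.3 (p. 22, "Construction and Analysis of g"; p. 23, "all the computations can be done in PSPACE")] -/
theorem mem_stageList_iff_linFormTest (x₀ : List Bool) (tabs : ℕ → Set (List Bool)) (n : ℕ) (u : List Bool) :
    u ∈ P.stageList x₀ tabs n ↔
      ∃ (k : ℕ) (e : Fin (k + 1 + 1) ↪ Fin (P.nq x₀)), (P.gates x₀)[n]? = some (.oracle (k + 1) e) ∧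
        u.length = k ∧ (2 ^ k ≤ P.bud x₀ ∨ (¬ 2 ^ k ≤ P.bud x₀ ∧
          linFormTest (2 ^ hCount ((P.gates x₀).take n)) (-(P.bud x₀ : ℤ)) 0
            (annSetA (AcSim.annTab tabs ((P.gates x₀).take n)) (P.w0 x₀) {x | queryOf e x = true :: u})
            (annSetB (AcSim.annTab tabs ((P.gates x₀).take n)) (P.w0 x₀) {x | queryOf e x = true :: u})
            0 0 = false)) := by
  unfold stageList
  cases hg : (P.gates x₀)[n]? with
  | none => simp
  | some g =>
    simp only [Option.some.injEq]
    rw [P.tabRun_take_eq_annProd, AcSim.mem_stageListOf_annProd_iff (P.bud_pos x₀), AcSim.annHCount_annTab]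

/-- **`HeavyLang` by the integer test** (instances `⟨w, ⟨h, ⟨ν, u⟩⟩⟩`, `w = ⟨x₀, r⟩`, stage `|ν|`,
tables read off `h`). [cite: AaronsonChen2017, §5.3 (pp. 22–23)] -/
theorem mem_HeavyLang_iff_linFormTest (w h ν u : List Bool) :
    boolPair w (boolPair h (boolPair ν u)) ∈ P.HeavyLang ↔
      ∃ (k : ℕ) (e : Fin (k + 1 + 1) ↪ Fin (P.nq (boolUnpair w).1)),
        (P.gates (boolUnpair w).1)[ν.length]? = some (.oracle (k + 1) e) ∧ u.length = k ∧
        (2 ^ k ≤ P.bud (boolUnpair w).1 ∨ (¬ 2 ^ k ≤ P.bud (boolUnpair w).1 ∧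
          linFormTest (2 ^ hCount ((P.gates (boolUnpair w).1).take ν.length)) (-(P.bud (boolUnpair w).1 : ℤ)) 0
            (annSetA (AcSim.annTab (P.tabsOf (boolUnpair w).1 (boolUnpair w).2 h) ((P.gates (boolUnpair w).1).take ν.length))
              (P.w0 (boolUnpair w).1) {x | queryOf e x = true :: u})
            (annSetB (AcSim.annTab (P.tabsOf (boolUnpair w).1 (boolUnpair w).2 h) ((P.gates (boolUnpair w).1).take ν.length))
              (P.w0 (boolUnpair w).1) {x | queryOf e x = true :: u})
            0 0 = false)) := by
  rw [mem_HeavyLang_iff, mem_stageList_iff_linFormTest]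

/-- **The selection predicate by the integer test**: `Sel x₀ r h i` (`r/2^{|r|} < F(i)`, `F` the
cumulative Born law of the final tabled state in numeral order) iff `i` is a label index and the
linear-form test `0 < 2^{|r|}·2^h·W({y | ⟦y⟧ ≤ i}) − ⟦r⟧·2^h` holds on the pair counts of the
annotated gate list from `w0`. [cite: AaronsonChen2017, §5.3 (p. 23, "takes a sample z by measuring |v_{T+1}⟩")] [cite: KnuthTAOCP2, §3.4.1 A] -/
theorem sel_iff_linFormTest (x₀ r h : List Bool) (i : ℕ) :
    P.Sel x₀ r h i ↔ i < 2 ^ P.nq x₀ ∧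
      linFormTest (-((bitsToNat r : ℤ) * 2 ^ hCount (P.gates x₀))) (2 ^ r.length) 0
        (annSetA (AcSim.annTab (P.tabsOf x₀ r h) (P.gates x₀)) (P.w0 x₀) {y | bitsToNat (List.ofFn y) ≤ i})
        (annSetB (AcSim.annTab (P.tabsOf x₀ r h) (P.gates x₀)) (P.w0 x₀) {y | bitsToNat (List.ofFn y) ≤ i})
        0 0 = true := by
  unfold Sel
  rw [P.tabRun_eq_annProd]
  constructor
  · rintro ⟨hi, hlt⟩
    refine ⟨hi, ?_⟩
    rw [cdfR_map_qregEquiv_eq_annWeight] at hlt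
    have := (lt_mul_annWeight_iff (bitsToNat r) (2 ^ r.length) _ (P.w0 x₀) {y | bitsToNat (List.ofFn y) ≤ i}).1
      (by exact_mod_cast hlt)
    rwa [AcSim.annHCount_annTab] at this
  · rintro ⟨hi, ht⟩
    refine ⟨hi, ?_⟩
    rw [cdfR_map_qregEquiv_eq_annWeight]
    have := (lt_mul_annWeight_iff (bitsToNat r) (2 ^ r.length) _ (P.w0 x₀) {y | bitsToNat (List.ofFn y) ≤ i}).2
      (by rwa [AcSim.annHCount_annTab])
    exact_mod_cast this

/-- **`CdfLang` by the integer test** (instances `⟨w, ⟨h, Y⟩⟩`, `w = ⟨x₀, r⟩`).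
[cite: AaronsonChen2017, §5.3 (p. 23)] -/
theorem mem_CdfLang_iff_linFormTest (w h Y : List Bool) :
    boolPair w (boolPair h Y) ∈ P.CdfLang ↔
      Y.length = P.nq (boolUnpair w).1 ∧ bitsToNat Y < 2 ^ P.nq (boolUnpair w).1 ∧
      linFormTest (-((bitsToNat (boolUnpair w).2 : ℤ) * 2 ^ hCount (P.gates (boolUnpair w).1)))
        (2 ^ (boolUnpair w).2.length) 0
        (annSetA (AcSim.annTab (P.tabsOf (boolUnpair w).1 (boolUnpair w).2 h) (P.gates (boolUnpair w).1))
          (P.w0 (boolUnpair w).1) {y | bitsToNat (List.ofFn y) ≤ bitsToNat Y})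
        (annSetB (AcSim.annTab (P.tabsOf (boolUnpair w).1 (boolUnpair w).2 h) (P.gates (boolUnpair w).1))
          (P.w0 (boolUnpair w).1) {y | bitsToNat (List.ofFn y) ≤ bitsToNat Y})
        0 0 = true := by
  rw [mem_CdfLang_iff, sel_iff_linFormTest]

end AcProto

end Literature.Barriers.QuantumAdvantage

end
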